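import Summits.Ventures.PercRepro.SixThreeStep5C

/-!
# PercRepro — Step 5 of Lemma PL (`g ≥ 41`), continuation `SixThreeStep5D` (p3 gen 8; split of the gen-7 module
`SixThreeStep5.lean` into five parts per the 400-line lint, proofs byte-identical, preambles only)

Parts V (second half)–VI of the original module: the polynomial-versus-exponential facts (`loss_le`) and the short
lines `B_t(g, m) ≥ −15·(3 + 2g + C(g,2))·2^m` (`B_ge`).  Continues in `SixThreeStep5.lean`.
-/

namespace PercRepro.SixThree.Table

/-! ### The polynomial-versus-exponential facts -/

/-- `x^5 ≥ 41 x^4`, … chains for `x ≥ 41`. -/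
theorem pow_chain {x : ℚ} (hx : 41 ≤ x) :
    41 * x ≤ x ^ 2 ∧ 41 * x ^ 2 ≤ x ^ 3 ∧ 41 * x ^ 3 ≤ x ^ 4 ∧ 41 * x ^ 4 ≤ x ^ 5 := by
  have h0 : (0 : ℚ) ≤ x := by linarith
  refine ⟨?_, ?_, ?_, ?_⟩
  · nlinarith
  · have : 41 * x ^ 2 ≤ x * x ^ 2 := mul_le_mul_of_nonneg_right hx (by positivity)
    linarith [show x * x ^ 2 = x ^ 3 by ring]
  · have : 41 * x ^ 3 ≤ x * x ^ 3 := mul_le_mul_of_nonneg_right hx (by positivity)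
    linarith [show x * x ^ 3 = x ^ 4 by ring]
  · have : 41 * x ^ 4 ≤ x * x ^ 4 := mul_le_mul_of_nonneg_right hx (by positivity)
    linarith [show x * x ^ 4 = x ^ 5 by ring]

/-- `(x + 1)^5 ≤ 2 x^5` for `x ≥ 41`. -/
theorem succ_pow_five_le {x : ℚ} (hx : 41 ≤ x) : (x + 1) ^ 5 ≤ 2 * x ^ 5 := by
  obtain ⟨h1, h2, h3, h4⟩ := pow_chain hx
  have e : (x + 1) ^ 5 = x ^ 5 + 5 * x ^ 4 + 10 * x ^ 3 + 10 * x ^ 2 + 5 * x + 1 := by ring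
  rw [e]
  linarith

/-- `3200·g^5 ≤ 2^g` for `g ≥ 41`. -/
theorem poly_le_two_pow {g : ℕ} (hg : 41 ≤ g) : 3200 * (g : ℚ) ^ 5 ≤ 2 ^ g := by
  induction g, hg using Nat.le_induction with
  | base => norm_num
  | succ n hn ih =>
    have h := succ_pow_five_le (x := n) (by exact_mod_cast hn)
    have e : (2 : ℚ) ^ (n + 1) = 2 * 2 ^ n := by ring
    push_cast
    rw [e]
    linarith

/-- `C(g, r) ≤ g^r` in `ℚ`. -/
theorem choose_le_pow_cast (g r : ℕ) : ((g.choose r : ℕ) : ℚ) ≤ (g : ℚ) ^ r := by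
  have h := Nat.choose_le_pow_div (α := ℚ) r g
  have hf : (1 : ℚ) ≤ (r.factorial : ℕ) := by exact_mod_cast Nat.one_le_iff_ne_zero.2 (Nat.factorial_ne_zero r)
  have hp : (0 : ℚ) ≤ (g : ℚ) ^ r := by positivity
  calc ((g.choose r : ℕ) : ℚ) ≤ (g : ℚ) ^ r / (r.factorial : ℕ) := h
    _ ≤ (g : ℚ) ^ r / 1 := div_le_div_of_nonneg_left hp (by norm_num) hf
    _ = (g : ℚ) ^ r := div_one _

/-- `S₅(g) ≤ 1 + g + g² + g³ + g⁴ + g⁵`. -/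
theorem S5_le (g : ℕ) : S5 g ≤ 1 + g + (g : ℚ) ^ 2 + (g : ℚ) ^ 3 + (g : ℚ) ^ 4 + (g : ℚ) ^ 5 := by
  unfold S5
  simp only [Finset.sum_range_succ, Finset.sum_range_zero, Nat.choose_zero_right, Nat.choose_one_right]
  push_cast
  have h2 := choose_le_pow_cast g 2
  have h3 := choose_le_pow_cast g 3
  have h4 := choose_le_pow_cast g 4
  have h5 := choose_le_pow_cast g 5
  linarith

/-- `S₂(m) ≤ 1 + m + m²`, `S₃(m) ≤ 1 + m + m² + m³`. -/
theorem S2_le (m : ℕ) : S2 m ≤ 1 + m + (m : ℚ) ^ 2 := by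
  unfold S2; have := choose_le_pow_cast m 2; linarith
/-- `S₃(m) ≤ 1 + m + m² + m³`. -/
theorem S3_le (m : ℕ) : S3 m ≤ 1 + m + (m : ℚ) ^ 2 + (m : ℚ) ^ 3 := by
  unfold S3; have := choose_le_pow_cast m 2; have := choose_le_pow_cast m 3; linarith

/-- `S₂, S₃, S₅ ≥ 0`. -/
theorem S2_nonneg (m : ℕ) : 0 ≤ S2 m := by unfold S2; positivity
/-- `S₃ ≥ 0`. -/
theorem S3_nonneg (m : ℕ) : 0 ≤ S3 m := by unfold S3; positivity
/-- `S₅ ≥ 0`. -/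
theorem S5_nonneg (g : ℕ) : 0 ≤ S5 g := by unfold S5; positivity
/-- `S₂ m ≤ 2^m` for `m ≥ 2`. -/
theorem S2_le_two_pow {m : ℕ} (hm : 2 ≤ m) : S2 m ≤ 2 ^ m := by
  have h := sum_Icc_three_choose hm
  have : (0 : ℚ) ≤ ((∑ s ∈ Finset.Icc 3 m, m.choose s : ℕ) : ℚ) := by positivity
  linarith

/-- Monotonicity of `S₂`, `S₃` in `m`. -/
theorem S2_mono {m n : ℕ} (h : m ≤ n) : S2 m ≤ S2 n := by
  unfold S2
  have := Nat.choose_le_choose 2 h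
  have h' : ((m.choose 2 : ℕ) : ℚ) ≤ ((n.choose 2 : ℕ) : ℚ) := by exact_mod_cast this
  have hm : (m : ℚ) ≤ n := by exact_mod_cast h
  linarith
/-- `S₃` is monotone. -/
theorem S3_mono {m n : ℕ} (h : m ≤ n) : S3 m ≤ S3 n := by
  unfold S3
  have h2 : ((m.choose 2 : ℕ) : ℚ) ≤ ((n.choose 2 : ℕ) : ℚ) := by exact_mod_cast Nat.choose_le_choose 2 h
  have h3 : ((m.choose 3 : ℕ) : ℚ) ≤ ((n.choose 3 : ℕ) : ℚ) := by exact_mod_cast Nat.choose_le_choose 3 h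
  have hm : (m : ℚ) ≤ n := by exact_mod_cast h
  linarith

/-- **The loss is at most `2^g / 100`** for `g ≥ 41`, `m ≤ g`. -/
theorem loss_le {t g m : ℕ} (ht : t = 1 ∨ t = 2 ∨ t = 3) (hg : 41 ≤ g) (hm : m ≤ g) : loss t g m ≤ 2 ^ g / 100 := by
  have hx : (41 : ℚ) ≤ g := by exact_mod_cast hg
  obtain ⟨c1, c2, c3, c4⟩ := pow_chain hx
  have hP := poly_le_two_pow hg
  -- the pieces
  have hj : ((g - m : ℕ) : ℚ) ≤ g := by exact_mod_cast Nat.sub_le g m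
  have hjc : (((g - m).choose 2 : ℕ) : ℚ) ≤ (g : ℚ) ^ 2 :=
    (choose_le_pow_cast (g - m) 2).trans (pow_le_pow_left₀ (by positivity) hj 2)
  have hmg : (m : ℚ) ≤ g := by exact_mod_cast hm
  have hS3 : S3 m ≤ 1 + g + (g : ℚ) ^ 2 + (g : ℚ) ^ 3 := (S3_mono hm).trans (S3_le g)
  have hS2 : S2 m ≤ 1 + g + (g : ℚ) ^ 2 := (S2_mono hm).trans (S2_le g)
  have hS5 := S5_le g
  have h0 : (0 : ℚ) ≤ g := by positivity
  have hvl := vLp5_le ht; have hvn := vNon5_le ht; have hr := r6_le ht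
  have hvl0 := vLp5_nonneg ht; have hvn0 := vNon5_nonneg ht
  have hr0 : (0 : ℚ) ≤ r6 t := by linarith [r6_ge ht]
  have hi : (0 : ℚ) ≤ (if t = 3 then (3 : ℚ) else 0) ∧ (if t = 3 then (3 : ℚ) else 0) ≤ 3 := by
    split_ifs <;> norm_num
  have hS3n := S3_nonneg m; have hS2n := S2_nonneg m; have hS5n := S5_nonneg g
  -- the coefficient of `S₃ m` is at most `15 (g + g²)`
  have hcoef : vLp5 t * ((g - m : ℕ) : ℚ) + vNon5 t * (((g - m).choose 2 : ℕ) : ℚ) ≤ 15 * (g + (g : ℚ) ^ 2) := by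
    have := mul_le_mul hvl hj (by positivity) (by norm_num)
    have := mul_le_mul hvn hjc (by positivity) (by norm_num)
    linarith
  have hcoef0 : 0 ≤ vLp5 t * ((g - m : ℕ) : ℚ) + vNon5 t * (((g - m).choose 2 : ℕ) : ℚ) := by positivity
  unfold loss
  have t1 : (vLp5 t * ((g - m : ℕ) : ℚ) + vNon5 t * (((g - m).choose 2 : ℕ) : ℚ)) * S3 m ≤
      15 * (g + (g : ℚ) ^ 2) * (1 + g + (g : ℚ) ^ 2 + (g : ℚ) ^ 3) :=
    mul_le_mul hcoef hS3 hS3n (by positivity)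
  have t2 : r6 t * S5 g ≤ 15 * (1 + g + (g : ℚ) ^ 2 + (g : ℚ) ^ 3 + (g : ℚ) ^ 4 + (g : ℚ) ^ 5) :=
    mul_le_mul hr hS5 hS5n (by norm_num)
  have t3 : (if t = 3 then 3 else 0) * ((m : ℚ) + 1) ≤ 3 * ((g : ℚ) + 1) := by
    have hm1 : (m : ℚ) + 1 ≤ (g : ℚ) + 1 := by linarith
    have := mul_le_mul hi.2 hm1 (by positivity) (by norm_num)
    linarith
  -- `Lpoly ≤ 32 g^5 ≤ 2^g / 100`
  have hpoly : 15 * (g + (g : ℚ) ^ 2) * (1 + g + (g : ℚ) ^ 2 + (g : ℚ) ^ 3) +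
      15 * (1 + g + (g : ℚ) ^ 2 + (g : ℚ) ^ 3 + (g : ℚ) ^ 4 + (g : ℚ) ^ 5) + 3 * (1 + g + (g : ℚ) ^ 2) +
      3 * (g + 1) ≤ 32 * (g : ℚ) ^ 5 := by nlinarith
  linarith


/-! ## Part VI: the short lines — `B_t(g, m) ≥ −15·(3 + 2g + C(g,2))·2^m` -/

/-- The demand difference of one line: `D_t(g, [m]) − D_t(g, []) = −3·(1 + [t = 3])·E(m)`, `E(m) = 2^m − S₂(m)`. -/
theorem D_single_sub_nil {t g : ℕ} (ht : t = 1 ∨ t = 2 ∨ t = 3) (hg : 2 ≤ g) (m : ℕ) :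
    D t g [m] - D t g [] = -(3 * (1 + (if t = 3 then 1 else 0)) * (2 ^ m - S2 m)) := by
  have hN := N3cnt_single hg m
  have hN0 := N3cnt_nil hg
  have hC := C2_single g m
  have hC0 := C2_nil g
  rcases ht with rfl | rfl | rfl <;> simp only [D] <;> rw [hN, hN0] <;> try rw [hC, hC0]
  · simp; ring
  · simp; ring
  · simp only [S2] at *; simp; ring

/-- `E(m) = 2^m − S₂(m) ≥ 0` for `m ≥ 2`. -/
theorem E_nonneg {m : ℕ} (hm : 2 ≤ m) : 0 ≤ (2 : ℚ) ^ m - S2 m := by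
  have := S2_le_two_pow hm; linarith

/-- The summand difference of one line is at least `−15·(C(m,s) + (g−m)·C(m,s−1) + C(g−m,2)·C(m,s−2))` for `s ≥ 5`. -/
theorem summand_single_sub_nil_ge {t g m : ℕ} (ht : t = 1 ∨ t = 2 ∨ t = 3) {s : ℕ} (hs : 5 ≤ s) :
    -(15 * (((m.choose s : ℕ) : ℚ) + ((g - m : ℕ) : ℚ) * ((m.choose (s - 1) : ℕ) : ℚ) +
      (((g - m).choose 2 : ℕ) : ℚ) * ((m.choose (s - 2) : ℕ) : ℚ))) ≤ summand t g [m] s - summand t g [] s := by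
  rw [summand_nil]
  unfold summand
  have hl : 0 ≤ lps g [m] s * vLp t s := mul_nonneg (by rw [lps_single]; positivity) (vLp_nonneg ht s)
  have hA : (0 : ℚ) ≤ ((m.choose s : ℕ) : ℚ) := by positivity
  have hB : (0 : ℚ) ≤ ((g - m : ℕ) : ℚ) * ((m.choose (s - 1) : ℕ) : ℚ) := by positivity
  have hC : (0 : ℚ) ≤ (((g - m).choose 2 : ℕ) : ℚ) * ((m.choose (s - 2) : ℕ) : ℚ) := by positivity
  have hvr := vRest_le ht s; have hvr0 := vRest_nonneg ht s
  have hvn := vNon_le ht s; have hvn0 := vNon_nonneg ht s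
  split_ifs with h6
  · -- `s ≥ 6`: `ds[m] ≥ 0`, `rests[m] − C(g,s) = −(C(m,s) + j C(m,s−1) + C(j,2) C(m,s−2))`
    have hd : 0 ≤ ds g [m] s * vNon t s := mul_nonneg (by rw [ds_single, if_pos h6]; positivity) hvn0
    have e : rests g [m] s = ((g.choose s : ℕ) : ℚ) - (((m.choose s : ℕ) : ℚ) + ((g - m : ℕ) : ℚ) * ((m.choose (s - 1) : ℕ) : ℚ) +
        (((g - m).choose 2 : ℕ) : ℚ) * ((m.choose (s - 2) : ℕ) : ℚ)) := by
      rw [rests_single, ds_single, if_pos h6]; ring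
    rw [e]
    have key : -(((m.choose s : ℕ) : ℚ) + ((g - m : ℕ) : ℚ) * ((m.choose (s - 1) : ℕ) : ℚ) +
        (((g - m).choose 2 : ℕ) : ℚ) * ((m.choose (s - 2) : ℕ) : ℚ)) * vRest t s ≥
        -(((m.choose s : ℕ) : ℚ) + ((g - m : ℕ) : ℚ) * ((m.choose (s - 1) : ℕ) : ℚ) +
        (((g - m).choose 2 : ℕ) : ℚ) * ((m.choose (s - 2) : ℕ) : ℚ)) * 15 := by
      apply mul_le_mul_of_nonpos_left hvr; linarith
    nlinarith
  · -- `s = 5`: `rests[m] = 0`, `ds[m] − C(g,5) = −(C(m,5) + j C(m,4))`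
    have h5 : s = 5 := by omega
    subst h5
    rw [rests_single_five, zero_mul, add_zero]
    have e : ds g [m] 5 = ((g.choose 5 : ℕ) : ℚ) - (((m.choose 5 : ℕ) : ℚ) + ((g - m : ℕ) : ℚ) * ((m.choose 4 : ℕ) : ℚ)) := by
      rw [ds_single]; simp only [show ¬ (6 ≤ 5) by norm_num, if_false]; ring
    rw [e]
    have key : -(((m.choose 5 : ℕ) : ℚ) + ((g - m : ℕ) : ℚ) * ((m.choose 4 : ℕ) : ℚ)) * vNon t 5 ≥
        -(((m.choose 5 : ℕ) : ℚ) + ((g - m : ℕ) : ℚ) * ((m.choose 4 : ℕ) : ℚ)) * 15 := by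
      apply mul_le_mul_of_nonpos_left hvn; linarith
    have hA' : (0 : ℚ) ≤ ((m.choose 5 : ℕ) : ℚ) := by positivity
    have hB' : (0 : ℚ) ≤ ((g - m : ℕ) : ℚ) * ((m.choose 4 : ℕ) : ℚ) := by positivity
    simp only [show (5 : ℕ) - 1 = 4 by norm_num, show (5 : ℕ) - 2 = 3 by norm_num] at hB hC ⊢
    nlinarith

/-- `Σ_{s ∈ Icc 5 g} (C(m,s) + (g−m) C(m,s−1) + C(g−m,2) C(m,s−2)) ≤ (1 + (g − m) + C(g−m,2))·2^m` for `g ≥ 5`. -/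
theorem sum_three_choose_le {g m : ℕ} (hg : 5 ≤ g) :
    ∑ s ∈ Finset.Icc 5 g, (((m.choose s : ℕ) : ℚ) + ((g - m : ℕ) : ℚ) * ((m.choose (s - 1) : ℕ) : ℚ) +
      (((g - m).choose 2 : ℕ) : ℚ) * ((m.choose (s - 2) : ℕ) : ℚ)) ≤
      (1 + ((g - m : ℕ) : ℚ) + (((g - m).choose 2 : ℕ) : ℚ)) * 2 ^ m := by
  simp only [Finset.sum_add_distrib, ← Finset.mul_sum]
  have h1 : ∑ s ∈ Finset.Icc 5 g, ((m.choose s : ℕ) : ℚ) ≤ 2 ^ m := by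
    exact_mod_cast sum_Icc_choose_le m 5 g
  have h2 : ∑ s ∈ Finset.Icc 5 g, ((m.choose (s - 1) : ℕ) : ℚ) ≤ 2 ^ m := by
    exact_mod_cast sum_Icc_choose_sub_le m (a := 5) (b := g) (k := 1) (by norm_num) hg
  have h3 : ∑ s ∈ Finset.Icc 5 g, ((m.choose (s - 2) : ℕ) : ℚ) ≤ 2 ^ m := by
    exact_mod_cast sum_Icc_choose_sub_le m (a := 5) (b := g) (k := 2) (by norm_num) hg
  have hj : (0 : ℚ) ≤ ((g - m : ℕ) : ℚ) := by positivity
  have hc : (0 : ℚ) ≤ (((g - m).choose 2 : ℕ) : ℚ) := by positivity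
  nlinarith [mul_le_mul_of_nonneg_left h2 hj, mul_le_mul_of_nonneg_left h3 hc]

/-- **The short-line bound**: `B_t(g, m) ≥ −15·(3 + 2g + C(g,2))·2^m` for `3 ≤ m ≤ g`, `g ≥ 5`. -/
theorem B_ge {t g m : ℕ} (ht : t = 1 ∨ t = 2 ∨ t = 3) (hm3 : 3 ≤ m) (hmg : m ≤ g) (hg : 5 ≤ g) :
    -(15 * (3 + 2 * (g : ℚ) + ((g.choose 2 : ℕ) : ℚ)) * 2 ^ m) ≤ B t g m := by
  have hB : B t g m = (F t g [m] - F t g []) - (D t g [m] - D t g []) := by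
    simp only [B, A, Δ]; ring
  rw [hB, D_single_sub_nil ht (by omega) m]
  have hE := E_nonneg (m := m) (by omega)
  have hi : (0 : ℚ) ≤ (if t = 3 then (1 : ℚ) else 0) := by split_ifs <;> norm_num
  -- `F[m] − F[]`
  have eF : F t g [m] - F t g [] = (Tcnt g [m] - Tcnt g []) * vTriple t + (N4g g [m] - N4g g []) * vGen4 t +
      (N4c g [m] - N4c g []) * vCol4 t + sumIcc (fun s => summand t g [m] s - summand t g [] s) 5 g := by
    rw [sumIcc_sub]
    have e1 : F t g [m] = Tcnt g [m] * vTriple t + N4g g [m] * vGen4 t + N4c g [m] * vCol4 t +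
        sumIcc (summand t g [m]) 5 g := rfl
    have e2 : F t g [] = Tcnt g [] * vTriple t + N4g g [] * vGen4 t + N4c g [] * vCol4 t +
        sumIcc (summand t g []) 5 g := rfl
    rw [e1, e2]; ring
  rw [eF]
  -- the three leading differences
  have hT : -(15 * ((m.choose 3 : ℕ) : ℚ)) ≤ (Tcnt g [m] - Tcnt g []) * vTriple t := by
    rw [Tcnt_single, Tcnt_nil]
    have h := vTriple_le ht
    have h0 := vTriple_nonneg ht
    have : (0 : ℚ) ≤ ((m.choose 3 : ℕ) : ℚ) := by positivity
    nlinarith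
  have hG : -(15 * (((m.choose 4 : ℕ) : ℚ) + ((g - m : ℕ) : ℚ) * ((m.choose 3 : ℕ) : ℚ))) ≤
      (N4g g [m] - N4g g []) * vGen4 t := by
    have e4 : N4g g [] = ((g.choose 4 : ℕ) : ℚ) := by
      simp only [N4g, Tcnt_nil, N4c_nil, mul_zero, sub_zero]
      have h1 : (g.choose 4 : ℚ) * 4 = (g.choose 3 : ℚ) * ((g - 3 : ℕ) : ℚ) := by
        exact_mod_cast Nat.choose_succ_right_eq g 3
      linarith
    rw [N4g_single hm3 hmg, e4]
    have h := vGen4_le ht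
    have h0 := vGen4_nonneg ht
    have : (0 : ℚ) ≤ ((m.choose 4 : ℕ) : ℚ) + ((g - m : ℕ) : ℚ) * ((m.choose 3 : ℕ) : ℚ) := by positivity
    nlinarith
  have hC : 0 ≤ (N4c g [m] - N4c g []) * vCol4 t := by
    rw [N4c_single, N4c_nil, sub_zero]
    exact mul_nonneg (by positivity) (vCol4_nonneg ht)
  -- the sum
  have hS : -(15 * ((1 + ((g - m : ℕ) : ℚ) + (((g - m).choose 2 : ℕ) : ℚ)) * 2 ^ m)) ≤
      sumIcc (fun s => summand t g [m] s - summand t g [] s) 5 g := by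
    have h1 := sumIcc_le_sumIcc 5 (fun s hs => summand_single_sub_nil_ge ht hs (t := t) (g := g) (m := m)) g
    rw [sumIcc_eq_finset] at h1
    have h2 := sum_three_choose_le (m := m) hg
    rw [Finset.sum_neg_distrib, ← Finset.mul_sum] at h1
    linarith
  -- assemble: `C(m,3), C(m,4) ≤ 2^m`, `g − m ≤ g`, `C(g−m,2) ≤ C(g,2)`
  have c3 : ((m.choose 3 : ℕ) : ℚ) ≤ 2 ^ m := by
    have := sum_Icc_choose_le m 3 3
    rw [Finset.Icc_self, Finset.sum_singleton] at this
    exact_mod_cast this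
  have c4 : ((m.choose 4 : ℕ) : ℚ) ≤ 2 ^ m := by
    have := sum_Icc_choose_le m 4 4
    rw [Finset.Icc_self, Finset.sum_singleton] at this
    exact_mod_cast this
  have hj : ((g - m : ℕ) : ℚ) ≤ g := by exact_mod_cast Nat.sub_le g m
  have hj0 : (0 : ℚ) ≤ ((g - m : ℕ) : ℚ) := by positivity
  have hjc : (((g - m).choose 2 : ℕ) : ℚ) ≤ ((g.choose 2 : ℕ) : ℚ) := by
    exact_mod_cast Nat.choose_le_choose 2 (Nat.sub_le g m)
  have hp : (0 : ℚ) ≤ 2 ^ m := by positivity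
  have hg0 : (0 : ℚ) ≤ g := by positivity
  nlinarith [mul_le_mul_of_nonneg_right hj hp, mul_le_mul_of_nonneg_left c3 hj0, mul_le_mul_of_nonneg_right hjc hp,
    mul_le_mul_of_nonneg_left c3 hg0]

end PercRepro.SixThree.Table
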